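import Mathlib.Order.Filter.AtTopBot.Tendsto
import Literature.ModelTheory.FiniteModelTheory.CountingWidth
import Literature.ModelTheory.FiniteModelTheory.CountingWidthXorHam
import Literature.Computability.MetaComplexity.RandomCNFFirstMoment
import HarnessLib

/-!
# Proof of the linear counting width of Hamiltonicity (Atserias–Dawar–Ochremiak 2021, Lemma 14)

Topic `Literature/ModelTheory/FiniteModelTheory` (sibling proofs file of `CountingWidth.lean`; the other sibling
`CountingWidthProofs.lean` discharges the 3-colourability fact). This file DISCHARGES the named fact
`AtseriasDawarOchremiak2021_hamiltonicity_countingWidth` of `CountingWidth.lean`: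

  `∃ d > 0, ∀ᶠ n, ∀ k, (Hamiltonicity is ≡^{C^k}-invariant on graphs on Fin n) → d·n ≤ k`,

i.e. for every large `N` there are graphs `G` (Hamiltonian) and `H` (not) on `Fin N` with
`H ≡^{C^k} G` for all `k < dN` (Atserias–Dawar–Ochremiak, arXiv:1901.07825, Lemma 14; J. ACM 68
(2021) Art. 26, §5.2). The printed proof — Theorem 3 (= Atserias–Dawar 2019, Thm 3.7/3.8: linear
lower bound for 3-XOR) plus "a minor modification of the textbook reduction from 3-SAT to
Hamiltonicity" and closure under interpretations — is formalised through the following chain, all of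
it now in the tree:

1. EXPANDERS (Chvátal–Szemerédi / Ben-Sasson–Wigderson counting, tree:
   `Literature.Computability.MetaComplexity.card_le_of_forall_not_isCoverExpander_linear` and
   `IsCoverExpander.isBoundaryExpander`): for every large `n` some family of `2n` scopes of size `3`
   over `n` variables is a `(⌊κn⌋, 1/2)`-boundary expander (`exists_coverExpander`,
   `exists_boundaryExpander`);
2. LOCAL CONSISTENCY (`XorLocalConsistency.lean`, Atserias–Dawar 2019 Lemma 3.5): every right-hand side
   over such scopes is consistent at radius `⌊κn⌋` with extension below `K = ⌊κn⌋/4`;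
3. THE GADGETS (`HamiltonianParitySystem*.lean`, `HamiltonianSubdivision.lean`): the padded split
   graphs of the parity gadget digraphs — Hamiltonian for the homogeneous system, non-Hamiltonian for
   an unsolvable right-hand side (which exists as `2n > n`, `exists_unsat`), of any prescribed size
   `573n + 6 + r`;
4. THE GAME (`CountingWidthXorHam.lean`, `CkEquivTransfer.lean`; Cai–Fürer–Immerman / Atserias–Dawar
   Lemma 3.2): the two padded gadgets are `≡^{C^k}` for `3k ≤ K`;
5. bookkeeping: `N ↦ n = (N-6)/573`, `r = N - 573n - 6`, transport to `Fin N`, and the choice of `d`.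

## References

* A. Atserias, A. Dawar, J. Ochremiak, *On the power of symmetric linear programs*, J. ACM 68 (2021)
  Art. 26; arXiv:1901.07825, §5.2: Theorem 3, Lemma 14. Read: arXiv pp. 21–23.
* A. Atserias, A. Dawar, *Definable inapproximability: new challenges for duplicator*, J. Log. Comput.
  29 (2019); arXiv:1806.11307, §3 (Lemmas 3.2, 3.5, Theorems 3.7–3.8). Read: arXiv pp. 9–13.
* V. Chvátal, E. Szemerédi, J. ACM 35 (1988), Lemma 1; E. Ben-Sasson, A. Wigderson, J. ACM 48 (2001),
  §5–6 (expansion of random constraint families; the tree's first-moment count).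
-/

noncomputable section

namespace Literature.ModelTheory.FiniteModelTheory

open Finset Filter Literature.Combinatorics.SimpleGraph Literature.Combinatorics.SimpleGraph.XorHam
open Literature.Computability.Complexity Literature.Computability.MetaComplexity

namespace XorHamGame

/-! ### Step 1: expanding scope families exist -/

/-- The constant `B = e^{1+a} Δ a` of the tree's first-moment count, at `k = 3` (`a = 7/4`),
`Δ = 2`. [cite: ChvatalSzemeredi1988, Lemma 1] -/
def cB : ℝ := Real.exp (1 + 7 / 4) * 2 * (7 / 4)

/-- The expansion radius `⌊n / (a (2B)^4)⌋`. [cite: ChvatalSzemeredi1988, Lemma 1] -/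
def radius (n : ℕ) : ℕ := ⌊(n : ℝ) / (7 / 4 * (2 * cB) ^ 4)⌋₊

/-- `B > 0`. [folklore] -/
theorem cB_pos : 0 < cB := by unfold cB; positivity

/-- **Some family of `2n` scopes of size `3` over `n` variables is a cover expander at linear
radius** (the first-moment count leaves room). [cite: ChvatalSzemeredi1988, Lemma 1] -/
theorem exists_coverExpander {n : ℕ} (hn3 : 3 ≤ n) (hbig : 32 * (7 / 4) * cB ^ 4 < n) :
    ∃ c : Fin (2 * n) → ↥(kClauses 3 n),
      IsCoverExpander (fun i => clauseScope (c i : Clause ℕ)) (radius n) (7 / 4) := by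
  by_contra hall
  simp only [not_exists] at hall
  have hK : (kClauses 3 n).Nonempty := by
    rw [← Finset.card_pos, card_kClauses]
    exact Nat.mul_pos (Nat.choose_pos hn3) (by norm_num)
  have hN : (7 / 4 : ℝ) * (radius n) ≤ n / (2 * cB) ^ 4 := by
    have h1 : (radius n : ℝ) ≤ n / (7 / 4 * (2 * cB) ^ 4) := Nat.floor_le (by positivity)
    have h2 : (0 : ℝ) < (2 * cB) ^ 4 := by have := cB_pos; positivity
    calc (7 / 4 : ℝ) * radius n ≤ 7 / 4 * (n / (7 / 4 * (2 * cB) ^ 4)) := by nlinarith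
      _ = n / (2 * cB) ^ 4 := by field_simp
  have h := card_le_of_forall_not_isCoverExpander_linear (k := 3) (Δ := 2) (a := 7 / 4) (B := cB) le_rfl
    (by norm_num) (by omega) hK (by norm_num) (by simp [cB]) hN Finset.univ (fun c _ => hall c)
  rw [Finset.card_univ, Fintype.card_fun, Fintype.card_coe, Fintype.card_fin] at h
  have hpos : (0 : ℝ) < (((kClauses 3 n).card ^ (2 * n) : ℕ) : ℝ) := by
    exact_mod_cast pow_pos (Finset.card_pos.2 hK) _
  have hlt : 32 * (7 / 4) * cB ^ 4 / n < 1 := by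
    rw [div_lt_one (by exact_mod_cast (show 0 < n by omega))]; exact hbig
  have := lt_of_le_of_lt h (mul_lt_of_lt_one_left hpos hlt)
  exact lt_irrefl _ this

/-- … hence a boundary expander with `c = 1/2`. [cite: BenSassonWigderson2001, §6] -/
theorem exists_boundaryExpander {n : ℕ} (hn3 : 3 ≤ n) (hbig : 32 * (7 / 4) * cB ^ 4 < n) :
    ∃ c : Fin (2 * n) → ↥(kClauses 3 n),
      IsBoundaryExpander (fun i => clauseScope (c i : Clause ℕ)) (radius n) (1 / 2) := by
  obtain ⟨c, hc⟩ := exists_coverExpander hn3 hbig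
  refine ⟨c, IsCoverExpander.isBoundaryExpander (k := 3)
    (fun i => (card_clauseScope_of_mem_kClauses (c i).2).le) ?_⟩
  rwa [show (((3 : ℕ) : ℝ) + 1 / 2) / 2 = 7 / 4 by norm_num]

/-! ### From clause tuples to scopes on `Fin n` -/

variable {n M : ℕ}

/-- The scope of the `u`-th clause as a set of variables in `Fin n`. [folklore] -/
def finScope (c : Fin M → ↥(kClauses 3 n)) (u : Fin M) : Finset (Fin n) :=
  (clauseScope (c u : Clause ℕ)).attachFin fun _ hv => Finset.mem_range.1 (clauseScope_subset_range (c u).2 hv)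

/-- Scopes have three variables. [folklore] -/
theorem card_finScope (c : Fin M → ↥(kClauses 3 n)) (u : Fin M) : (finScope c u).card = 3 := by
  rw [finScope, Finset.card_attachFin, card_clauseScope_of_mem_kClauses (c u).2]

/-- The scope maps `vr u : Fin 3 → Fin n` (increasing enumerations). [folklore] -/
def vrOf (c : Fin M → ↥(kClauses 3 n)) (u : Fin M) : Fin 3 → Fin n :=
  (finScope c u).orderEmbOfFin (card_finScope c u)

/-- The scope maps are injective. [folklore] -/
theorem vrOf_injective (c : Fin M → ↥(kClauses 3 n)) (u : Fin M) : Function.Injective (vrOf c u) :=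
  ((finScope c u).orderEmbOfFin (card_finScope c u)).injective

/-- The scope of `vrOf` is `finScope`. [folklore] -/
theorem scope_vrOf (c : Fin M → ↥(kClauses 3 n)) : scope (vrOf c) = finScope c := by
  funext u
  exact Finset.image_orderEmbOfFin_univ _ _

/-- The boundary over `Fin n` has the size of the boundary over `ℕ`. [folklore] -/
theorem card_boundary_finScope (c : Fin M → ↥(kClauses 3 n)) (T : Finset (Fin M)) :
    (boundary (fun i => clauseScope (c i : Clause ℕ)) T).card = (XorSystem.boundary (finScope c) T).card := by
  classical
  symm
  refine Finset.card_bij (fun v _ => (v : ℕ)) (fun v hv => ?_) (fun v _ w _ h => Fin.ext h) (fun w hw => ?_)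
  · simp only [XorSystem.boundary, Finset.mem_filter, Finset.mem_biUnion] at hv
    obtain ⟨⟨u, hu, hvu⟩, hdeg⟩ := hv
    rw [mem_boundary, mem_cover, coverDegree]
    refine ⟨⟨u, hu, (Finset.mem_attachFin _).1 hvu⟩, ?_⟩
    rw [← hdeg]
    congr 1
    ext u'
    simp only [Finset.mem_filter, finScope, Finset.mem_attachFin]
  · rw [mem_boundary, mem_cover, coverDegree] at hw
    obtain ⟨⟨u, hu, hwu⟩, hdeg⟩ := hw
    have hwn : w < n := Finset.mem_range.1 (clauseScope_subset_range (c u).2 hwu)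
    refine ⟨⟨w, hwn⟩, ?_, rfl⟩
    simp only [XorSystem.boundary, Finset.mem_filter, Finset.mem_biUnion]
    refine ⟨⟨u, hu, (Finset.mem_attachFin _).2 hwu⟩, ?_⟩
    rw [← hdeg]
    congr 1
    ext u'
    simp only [Finset.mem_filter, finScope, Finset.mem_attachFin]

/-- The expansion hypothesis in the integral form consumed by `ckEquiv_padGraph` (`q = 1`, `p = 2`).
[folklore] -/
theorem expansion_nat {c : Fin M → ↥(kClauses 3 n)} {s : ℕ}
    (h : IsBoundaryExpander (fun i => clauseScope (c i : Clause ℕ)) s (1 / 2)) (T : Finset (Fin M))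
    (hT : T.card ≤ s) : 1 * T.card ≤ 2 * (XorSystem.boundary (scope (vrOf c)) T).card := by
  rw [scope_vrOf, ← card_boundary_finScope, one_mul]
  have := h T (by exact_mod_cast hT)
  have h2 : ((T.card : ℕ) : ℝ) ≤ 2 * (boundary (fun i => clauseScope (c i : Clause ℕ)) T).card := by linarith
  exact_mod_cast h2

/-! ### Step 3: an unsolvable right-hand side -/

/-- **More constraints than variables leave an unsolvable right-hand side** (`2^n < 2^m`). [folklore] -/
theorem exists_unsat {n m : ℕ} (hnm : n < m) (vr : Fin m → Fin 3 → Fin n) :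
    ∃ b : Fin m → ZMod 2, ∀ x : Fin n → ZMod 2, ¬ ∀ u, ∑ i, x (vr u i) = b u := by
  classical
  let L : (Fin n → ZMod 2) → (Fin m → ZMod 2) := fun x u => ∑ i, x (vr u i)
  have hcard : Fintype.card (Fin n → ZMod 2) < Fintype.card (Fin m → ZMod 2) := by
    simp only [Fintype.card_fun, ZMod.card, Fintype.card_fin]
    exact Nat.pow_lt_pow_right (by norm_num) hnm
  have hns : ¬ Function.Surjective L := fun hs =>
    absurd (Fintype.card_le_of_surjective L hs) (not_le.2 hcard)
  obtain ⟨b, hb⟩ := not_forall.1 hns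
  refine ⟨b, fun x hx => hb ⟨x, funext hx⟩⟩

/-! ### Step 4: the hard pair on `Fin N` -/

/-- **The hard pair of graphs on `N = 573n + 6 + r` vertices**: `G` Hamiltonian, `H` not, and
`H ≡^{C^k} G` whenever `3k ≤ ⌊s/4⌋`, `s` the expansion radius.
[cite: AtseriasDawarOchremiak2021, §5.2, Lemma 14 of arXiv:1901.07825] -/
theorem hard_pair {n : ℕ} (hn : 1 ≤ n) {c : Fin (2 * n) → ↥(kClauses 3 n)} {s : ℕ} (hs : 1 ≤ s)
    (hexp : IsBoundaryExpander (fun i => clauseScope (c i : Clause ℕ)) s (1 / 2))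
    {k : ℕ} (hk : 3 * k ≤ s / 4) (r N : ℕ) (hN : 573 * n + 6 + r = N) :
    ∃ G H : SimpleGraph (Fin N), G.IsHamiltonian ∧ ¬ H.IsHamiltonian ∧ CkEquiv k H G := by
  classical
  obtain ⟨b, hb⟩ := exists_unsat (show n < 2 * n by omega) (vrOf c)
  have hcard : Fintype.card (PadV (Vtx n (2 * n) × Fin 3) r) = N := by
    rw [card_padV, Fintype.card_prod, Fintype.card_fin, Vtx.card_vtx]; omega
  let e : PadV (Vtx n (2 * n) × Fin 3) r ≃ Fin N := Fintype.equivFinOfCardEq hcard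
  let G₀ := padGraph (marked (vrOf c) 0) r
  let H₀ := padGraph (marked (vrOf c) b) r
  refine ⟨G₀.map e, H₀.map e, ?_, ?_, ?_⟩
  · exact (isHamiltonian_iff_of_iso (SimpleGraph.Iso.map e G₀)).1 (isHamiltonian_padGraph_zero (vrOf c) r)
  · intro hH
    obtain ⟨x, hx⟩ := exists_solution_of_isHamiltonian_padGraph
      ((isHamiltonian_iff_of_iso (SimpleGraph.Iso.map e H₀)).2 hH)
    exact hb x hx
  · have hK : 2 * 2 * (s / 4) ≤ 1 * s := by omega
    exact (ckEquiv_padGraph (vrOf_injective c) hs one_pos (expansion_nat hexp) hK hk b r).iso_congr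
      (SimpleGraph.Iso.map e H₀) (SimpleGraph.Iso.map e G₀)

/-! ### Step 5: bookkeeping -/

/-- The constant `d` of the theorem. [cite: AtseriasDawarOchremiak2021, §5.2, Lemma 14 of arXiv:1901.07825] -/
def dConst : ℝ := 1 / (7 / 4 * (2 * cB) ^ 4) / (12 * 574 * 3)

/-- `d > 0`. [folklore] -/
theorem dConst_pos : 0 < dConst := by
  unfold dConst; have := cB_pos; positivity

/-- A linear inequality with a larger slope on the right holds eventually. [folklore] -/
theorem eventually_linear_le {α β γ : ℝ} (h : α < γ) : ∀ᶠ n : ℕ in atTop, α * n + β ≤ γ * n := by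
  filter_upwards [eventually_ge_atTop ⌈β / (γ - α)⌉₊] with n hn
  have h1 : β / (γ - α) ≤ n := (Nat.le_ceil _).trans (by exact_mod_cast hn)
  rw [div_le_iff₀ (sub_pos.2 h)] at h1
  linarith

/-- The numerical requirements on `n` hold for all large `n`. [folklore] -/
theorem eventually_params : ∀ᶠ n : ℕ in atTop, 3 ≤ n ∧ 32 * (7 / 4) * cB ^ 4 < (n : ℝ) ∧ 1 ≤ radius n ∧
    3 * dConst * (573 * n + 579) ≤ ((radius n / 4 : ℕ) : ℝ) := by
  have hB := cB_pos
  have hD : (0 : ℝ) < 7 / 4 * (2 * cB) ^ 4 := by positivity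
  set κ : ℝ := 1 / (7 / 4 * (2 * cB) ^ 4) with hκ
  have hκpos : 0 < κ := by positivity
  have hrad : ∀ n : ℕ, κ * n - 1 ≤ radius n := fun n => by
    have := Nat.lt_floor_add_one ((n : ℝ) / (7 / 4 * (2 * cB) ^ 4))
    rw [radius]
    have e : κ * n = (n : ℝ) / (7 / 4 * (2 * cB) ^ 4) := by rw [hκ]; field_simp
    linarith
  have hdiv : ∀ n : ℕ, ((radius n : ℝ) / 4) - 1 ≤ ((radius n / 4 : ℕ) : ℝ) := fun n => by
    have := Nat.lt_div_mul_add (a := radius n) (show 0 < 4 by norm_num)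
    have h' : ((radius n : ℕ) : ℝ) < ((radius n / 4 * 4 + 4 : ℕ) : ℝ) := by exact_mod_cast this
    push_cast at h'; linarith
  have hslope : 3 * dConst * 573 < κ / 4 := by
    rw [dConst, ← hκ]
    nlinarith
  filter_upwards [eventually_ge_atTop 3, eventually_linear_le (β := 3 * dConst * 579 + 2) hslope,
    eventually_gt_atTop ⌈32 * (7 / 4) * cB ^ 4⌉₊, eventually_ge_atTop ⌈2 / κ⌉₊] with n hn3 hlin hbig hk1
  refine ⟨hn3, ?_, ?_, ?_⟩
  · exact Nat.lt_of_ceil_lt hbig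
  · have h1 : (2 / κ : ℝ) ≤ n := (Nat.le_ceil _).trans (by exact_mod_cast hk1)
    rw [div_le_iff₀ hκpos] at h1
    have h2 := hrad n
    have : (1 : ℝ) ≤ radius n := by nlinarith
    exact_mod_cast this
  · have h2 := hrad n
    have h3 := hdiv n
    nlinarith

/-- The block size map `N ↦ n = (N - 6) / 573` tends to infinity. [folklore] -/
theorem tendsto_blocks : Tendsto (fun N : ℕ => (N - 6) / 573) atTop atTop :=
  tendsto_atTop_atTop.2 fun b => ⟨573 * b + 6, fun N hN => by omega⟩

end XorHamGame

open XorHamGame in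
/-- **Linear counting width of Hamiltonicity** (Atserias–Dawar–Ochremiak 2021, Lemma 14 of
arXiv:1901.07825 = J. ACM 68(4) Art. 26, §5.2): discharge of the named fact
`AtseriasDawarOchremiak2021_hamiltonicity_countingWidth`. For every `N ≥ N₀` and every `k < dN` the
padded parity–Hamiltonicity gadgets of an unsolvable and of the homogeneous 3-XOR system over a boundary
expander, transported to `Fin N`, are a Hamiltonian and a non-Hamiltonian graph that are
`≡^{C^k}`-equivalent; so no such `k` makes Hamiltonicity `≡^{C^k}`-invariant.
[cite: AtseriasDawarOchremiak2021, §5.2, Lemma 14 of arXiv:1901.07825] -/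
theorem AtseriasDawarOchremiak2021_hamiltonicity_countingWidth_holds :
    AtseriasDawarOchremiak2021_hamiltonicity_countingWidth := by
  refine ⟨dConst, dConst_pos, ?_⟩
  filter_upwards [tendsto_blocks.eventually eventually_params, eventually_ge_atTop 6] with N hN hN6 k hk
  obtain ⟨hn3, hbig, hrad, hlin⟩ := hN
  by_contra hlt
  replace hlt := not_le.1 hlt
  set n := (N - 6) / 573 with hn
  have hNn : 573 * n + 6 ≤ N ∧ N < 573 * n + 579 := by omega
  obtain ⟨c, hc⟩ := exists_boundaryExpander hn3 hbig
  -- `3k ≤ ⌊radius/4⌋`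
  have hk3 : 3 * k ≤ radius n / 4 := by
    have h1 : (k : ℝ) < dConst * N := hlt
    have h2 : (N : ℝ) ≤ 573 * n + 579 := by exact_mod_cast hNn.2.le
    have h3 : (3 * k : ℝ) ≤ ((radius n / 4 : ℕ) : ℝ) := by nlinarith [dConst_pos]
    exact_mod_cast h3
  obtain ⟨G, H, hG, hH, hHG⟩ := hard_pair (by omega) hrad hc hk3 (N - (573 * n + 6)) N (by omega)
  exact hH ((hk H G hHG).2 hG)

end Literature.ModelTheory.FiniteModelTheory
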